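import Literature.MathematicalPhysics.QuantumFieldTheory.Balaban1983to89.HiggsLattice
import Literature.MathematicalPhysics.QuantumFieldTheory.Balaban1983to89.B1RT

/-!
# `Balaban1983to89.HiggsAveraging` — T. Bałaban, *(Higgs)₂,₃ quantum fields in a finite volume. I. A lower bound*,
Commun. Math. Phys. **85** (1982) 603–626 [Balaban1982Higgs1], Sect. 2 pp. 608–609: the contours `Γ_{y,x}`,
`Γ^{(k)}_{y,x}`, the averaging operators `Q(A)`, `Q_k(A)` and the Gaussian renormalization transformations (2.1)–(2.11)
as CONCRETE Mathlib definitions over the carrier `…Balaban1983to89.HiggsLattice` (tori, fields, `U(A)` of Sect. 1)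

statement-level skeleton of published theorems with citation tags; proofs where landed; nothing here is a claim about the Yang–Mills mass gap

PDF held: `paper:balaban1982-cmp85-higgs23-i` (journal page = PDF page + 602).  Displays read from the ×2 renders
`run/shared/lean/pub/pub-balaban/b2b-balaban-ref1/pages/1982-cmp85-higgs23-I/1982-cmp85-higgs23-I-p006, p007-x2.png` (pp. 608, 609).

CITATION HEADER (lean-in-tree rule).  Second CARRIER module of the lit-balaban typed skeleton for the (Higgs)₂,₃ papers
B1–B3 (HOME `run/shared/lean/pub/lit-balaban/`, SHARED-STRUCTURES.md §3), extending `…HiggsLattice` (Sect. 1 of the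
paper) and INSTANTIATING the two existing abstract modules of reader r01: `…Balaban1983to89.B1` (`B1.blockAvg` = the
common SHAPE of (2.7)/(2.11) over an abstract block system and abstract transports `hol y x`; `B1.aSeq` = (2.15)) and
`…Balaban1983to89.B1RT` (`B1RT.rtKernel`/`blockKernel`/`rtOp`/`prec` = the Gaussian kernels (2.5)–(2.6)/(2.10) and the
operator (2.4) over an ABSTRACT averaging map `m`, with (2.8) proved; its docstring: *"NOT typed here: the contours
(2.1)–(2.2) as lattice paths"*).  WHAT IS REPRODUCED here, as definitions with bodies (no statement of the paper is
asserted): the embeddings `T^{(k)} ⊂ T_ε` and the iterated blocks `B^k(y)` ((1.19)–(1.20); `toFinest`, `blockIter`,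
`blockK`); the staircase contours `Γ_{y,x}` (2.1) through the sums `A(Γ) = Σ_{b ⊂ Γ} A_b` (2.3) they are used for
(`segSum`, `corner`, `contourSum`) and the composite contours `Γ^{(k)}_{y,x}` (2.2) likewise (`multiContourSum`); the
CONCRETE transports `U(A(Γ_{y,x}))`, `U(A(Γ^{(k)}_{y,x}))` (`holQ`, `holQk`) and averaging operators
`(Q(A)φ)(y) = L^{-d} Σ_{x ∈ B(y)} U(A(Γ_{y,x})) φ(x)` (2.7) (`avgQ`), `(Q_k(A)f)(y) = L^{-kd} Σ_{x ∈ B^k(y)} U(A(Γ^{(k)}_{y,x})) f(x)`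
(2.11) (`avgQk`) as instances of `B1.blockAvg`; and the CONCRETE renormalization transformations of this model in the
case `Ω = T` used in the paper (p. 610: *"In this paper we will use the case Ω = T_ε only"*): the kernels (2.5)–(2.6)
and (2.10) (`rtKernelStep`, `rtKernelK`) and the operators (2.4) (`renormTransf`, `renormTransfK`) as instances of
`B1RT.blockKernel`/`B1RT.rtOp` at the printed precisions `a(L^{k+1}ε)^{d−2}`, `a_k(L^kε)^{d−2}` (`B1RT.prec`,
`B1.aSeq`), with the normalization (2.8) of the concrete one-step kernel obtained from `B1RT.integral_blockKernel`
(`integral_rtKernelStep`).  DELIBERATELY NOT HERE (reader-owned skeleton rows, r01): (2.9), (2.12), (2.14), (2.16), the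
covariances (2.17)–(2.22) on general `Ω` with Neumann boundary conditions, Props. 2.1–2.3 (typed in `…B1`).
CONVENTIONS (as in `…HiggsLattice`): the vector field `A` lives on the positively oriented bonds of the FINEST lattice
`T_ε = T^{(0)}` (p. 609: *"Here the external vector field A defined on T_ε is arbitrary"*), `U(A) = exp(qεeA)` with the
finest spacing `ε = mesh 0`; a segment of `Γ_{y,x}` runs in the POSITIVE coordinate direction from the `y`-coordinate to
the `x`-coordinate (for `x ∈ B(y)` one has `y_μ ≤ x_μ < y_μ + L^{k+1}ε` by (1.17), so this is the printed segment; for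
other pairs the definition is total and goes forward around the torus); the level index is meaningful for `k ≤ K`.
Unit `lit-balaban-typer` (literature-prover-lit-balaban-typer-0); HOME/FILED.md records the proposal.
v1.1 (append-only, no v1 declaration changed): Sect. 5 — linearity of the sums (2.3)/(2.2) in `A` and the
representation / unitarity properties of the transports `U(A(Γ))` inherited from `U` (p. 605; `HiggsLattice` v1.1
`ChargeData.U_add`, `U_zero`, `U_mem_unitary`), i.e. the hypothesis `hgroup` of the tree's `B1.display315` ((3.15))
and the isometry hypothesis `hiso` of `B2LargeField.norm_transport_sub_le` (II (2.16)) AT the concrete model — all PROVED.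
-/

open scoped BigOperators
open _root_.MeasureTheory

namespace Literature.MathematicalPhysics.QuantumFieldTheory.Balaban1983to89.HiggsAveraging

open Literature.MathematicalPhysics.QuantumFieldTheory.Balaban1983to89.HiggsLattice

variable {P : Params}

/-! ## 1. `T^{(k)} ⊂ T_ε` and the iterated blocks `B^k(y)` ((1.19)–(1.20)) -/

/-- The inclusion `T^{(k)}_{L^kε} ⊂ T_ε` ((1.19)–(1.20) p. 607, `T_ε = B^k(T^{(k)})`): label `v ↦ L^k v` (the `k`-fold
iterate of `HiggsLattice.emb`). [cite: Balaban1982Higgs1, (1.20) p.607] -/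
def toFinest {k : ℕ} (x : Site P k) : Site P 0 :=
  fun μ => (((x μ).val * P.L ^ k : ℕ) : ZMod (P.sitesPerDir 0 μ))

/-- The `j`-fold block map `T_ε → T^{(j)}`, `x ↦ x_j` with `x ∈ B^j(x_j)` (p. 608: *"Let us denote by x_j a point of
torus T^{(j)}_{L^jε}, such that x ∈ B^j(x_j). Of course x_k = y and x_j ∈ B(x_{j+1})"*). [cite: Balaban1982Higgs1, (2.2) p.608] -/
def blockIter : (j : ℕ) → Site P 0 → Site P j
  | 0, x => x
  | j + 1, x => blockOf (blockIter j x)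

/-- The iterated block `B^k(y) ⊂ T_ε` of `y ∈ T^{(k)}` ((1.18)–(1.20) p. 607), as a `Finset`. [cite: Balaban1982Higgs1, (1.20) p.607] -/
def blockK (k : ℕ) (y : Site P k) : Finset (Site P 0) := Finset.univ.filter fun x => blockIter k x = y

/-- `x ∈ B^k(y)` iff `x_k = y` (unfolding). [cite: Balaban1982Higgs1, (1.20) p.607] -/
theorem mem_blockK (k : ℕ) (y : Site P k) (x : Site P 0) : x ∈ blockK k y ↔ blockIter k x = y := by
  simp [blockK]

/-! ## 2. Contours and the sums `A(Γ)` ((2.1)–(2.3)) -/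

/-- `u + n εe_μ`: `n` steps forward in direction `μ` on `T_ε`. [cite: Balaban1982Higgs1, (2.1) p.608] -/
def shiftN (u : Site P 0) (μ : Fin P.d) (n : ℕ) : Site P 0 := Function.update u μ (u μ + n)

/-- `A(⟨u, u + nεe_μ⟩) = Σ_{i < n} A_{⟨u + iεe_μ, u + (i+1)εe_μ⟩}`: the sum (2.3) of a vector field along the straight
segment of `n` bonds from `u` in the positive direction `μ` (orientation = direction of traversal, p. 608: *"the bonds b
are taken with the orientations according to the orientation of Γ"*). [cite: Balaban1982Higgs1, (2.3) p.608] -/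
def segSum (A : VecField P 0) (u : Site P 0) (μ : Fin P.d) (n : ℕ) : ℝ :=
  ∑ i ∈ Finset.range n, A ⟨shiftN u μ i, μ⟩

/-- The corner `(y₁, …, y_i, x_{i+1}, …, x_d)` of the staircase contour (2.1) p. 608 at which the segment moving the
`i`-th coordinate starts (coordinates `≤ i` still those of `y`, coordinates `> i` already those of `x`). [cite: Balaban1982Higgs1, (2.1) p.608] -/
def corner (y x : Site P 0) (i : Fin P.d) : Site P 0 := fun j => if j ≤ i then y j else x j

/-- `A(Γ_{y,x})` for the staircase contour (2.1) p. 608,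
`Γ_{y,x} = ⟨y, (y₁,…,y_{d−1},x_d)⟩ ∪ ⟨(y₁,…,y_{d−1},x_d), (y₁,…,y_{d−2},x_{d−1},x_d)⟩ ∪ … ∪ ⟨(y₁,x₂,…,x_d), x⟩`
(oriented from `y` to `x`; the coordinates are adjusted in the order `d, d−1, …, 1`), summed as in (2.3): the `i`-th
segment starts at `corner y x i` and makes `(x_i − y_i) mod (period)` forward steps in direction `i`.  Both endpoints
are taken in `T_ε` (p. 608: the contour *"is composed of the bonds of ε-lattice"*). [cite: Balaban1982Higgs1, (2.1) p.608] -/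
def contourSum (A : VecField P 0) (y x : Site P 0) : ℝ :=
  ∑ i : Fin P.d, segSum A (corner y x i) i (x i - y i).val

/-- `A(Γ^{(k)}_{y,x})` for the composite contour (2.2) p. 608,
`Γ^{(k)}_{y,x} = Γ_{y,x_{k−1}} ∪ Γ_{x_{k−1},x_{k−2}} ∪ … ∪ Γ_{x₁,x}`, `y = x_k ∈ T^{(k)}`, `x ∈ B^k(y)`, `x_j ∈ T^{(j)}`,
`x ∈ B^j(x_j)`: the sum of the `k` staircase sums between consecutive block points of `x` (the coarse point `y` is
determined by `x` as `x_k = blockIter k x`). [cite: Balaban1982Higgs1, (2.2) p.608] -/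
def multiContourSum (A : VecField P 0) (k : ℕ) (x : Site P 0) : ℝ :=
  ∑ j ∈ Finset.range k, contourSum A (toFinest (blockIter (j + 1) x)) (toFinest (blockIter j x))

/-- For `k = 0` the composite contour is empty: `A(Γ^{(0)}_{x,x}) = 0`. [cite: Balaban1982Higgs1, (2.2) p.608] -/
theorem multiContourSum_zero (A : VecField P 0) (x : Site P 0) : multiContourSum A 0 x = 0 := by
  simp [multiContourSum]

/-- One more level: `A(Γ^{(k+1)}_{x_{k+1},x}) = A(Γ^{(k)}_{x_k,x}) + A(Γ_{x_{k+1},x_k})` (the concatenation in (2.2)). [cite: Balaban1982Higgs1, (2.2) p.608] -/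
theorem multiContourSum_succ (A : VecField P 0) (k : ℕ) (x : Site P 0) :
    multiContourSum A (k + 1) x
      = multiContourSum A k x + contourSum A (toFinest (blockIter (k + 1) x)) (toFinest (blockIter k x)) := by
  simp [multiContourSum, Finset.sum_range_succ]

/-! ## 3. The transports and the averaging operators `Q(A)` (2.7), `Q_k(A)` (2.11) — concrete instances of `B1.blockAvg` -/

section Averaging

variable {N : ℕ}

/-- The transport `U(A(Γ_{y,x}))` of (2.7) p. 608 along the staircase contour from `y ∈ T^{(k+1)}` to `x ∈ T^{(k)}`
(both regarded in `T_ε`), `U(A) = exp(qεeA)` of p. 605, as a linear map of `ℝ^N`. [cite: Balaban1982Higgs1, (2.7) p.608] -/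
noncomputable def holQ {k : ℕ} (C : ChargeData N) (A : VecField P 0) (y : Site P (k + 1)) (x : Site P k) :
    EuclideanSpace ℝ (Fin N) →ₗ[ℝ] EuclideanSpace ℝ (Fin N) :=
  (C.U (P.mesh 0) (contourSum A (toFinest y) (toFinest x))).toLinearMap

/-- The averaging operator (2.7) p. 608 from scalar fields on `T^{(k)}` to scalar fields on `T^{(k+1)}`:
`(Q(A)φ)(y) = L^{-d} Σ_{x ∈ B(y)} U(A(Γ_{y,x})) φ(x)` — the tree's abstract shape `B1.blockAvg` at the weight `L^{-d}`,
the corner blocks `B(y)` of (1.17) and the concrete transports `holQ`. [cite: Balaban1982Higgs1, (2.7) p.608] -/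
noncomputable def avgQ {k : ℕ} (C : ChargeData N) (A : VecField P 0) (φ : ScalarField P k N) :
    ScalarField P (k + 1) N :=
  B1.blockAvg (((P.L : ℝ) ^ P.d)⁻¹) block (holQ C A) φ

/-- Unfolding of (2.7): `(Q(A)φ)(y) = L^{-d} Σ_{x ∈ B(y)} U(A(Γ_{y,x})) φ(x)`. [cite: Balaban1982Higgs1, (2.7) p.608] -/
theorem avgQ_apply {k : ℕ} (C : ChargeData N) (A : VecField P 0) (φ : ScalarField P k N) (y : Site P (k + 1)) :
    avgQ C A φ y = (((P.L : ℝ) ^ P.d)⁻¹) •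
      ∑ x ∈ block y, C.U (P.mesh 0) (contourSum A (toFinest y) (toFinest x)) (φ x) := rfl

/-- The transport `U(A(Γ^{(k)}_{y,x}))` of (2.11) p. 609 along the composite contour (2.2) ending at `x ∈ B^k(y)`
(the contour, hence the transport, is determined by `x`; the block point `y = x_k` is carried for the shape of
`B1.blockAvg`). [cite: Balaban1982Higgs1, (2.11) p.609] -/
noncomputable def holQk (C : ChargeData N) (A : VecField P 0) (k : ℕ) (_y : Site P k) (x : Site P 0) :
    EuclideanSpace ℝ (Fin N) →ₗ[ℝ] EuclideanSpace ℝ (Fin N) :=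
  (C.U (P.mesh 0) (multiContourSum A k x)).toLinearMap

/-- The `k`-th order averaging operator (2.11) p. 609 from functions on `T_ε` to functions on `T^{(k)}`:
`(Q_k(A)f)(y) = L^{-kd} Σ_{x ∈ B^k(y)} U(A(Γ^{(k)}_{y,x})) f(x)` (`B1.blockAvg` at weight `L^{-kd}`, blocks `B^k(y)`,
transports `holQk`). [cite: Balaban1982Higgs1, (2.11) p.609] -/
noncomputable def avgQk (C : ChargeData N) (A : VecField P 0) (k : ℕ) (f : ScalarField P 0 N) : ScalarField P k N :=
  B1.blockAvg (((P.L : ℝ) ^ (k * P.d))⁻¹) (blockK k) (holQk C A k) f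

/-- Unfolding of (2.11): `(Q_k(A)f)(y) = L^{-kd} Σ_{x ∈ B^k(y)} U(A(Γ^{(k)}_{y,x})) f(x)`. [cite: Balaban1982Higgs1, (2.11) p.609] -/
theorem avgQk_apply (C : ChargeData N) (A : VecField P 0) (k : ℕ) (f : ScalarField P 0 N) (y : Site P k) :
    avgQk C A k f y = (((P.L : ℝ) ^ (k * P.d))⁻¹) •
      ∑ x ∈ blockK k y, C.U (P.mesh 0) (multiContourSum A k x) (f x) := rfl

end Averaging

/-! ## 4. The renormalization transformations of the model ((2.4)–(2.6), (2.10)) — concrete instances of `B1RT` -/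

section RT

variable {N : ℕ}

/-- The kernel (2.5)–(2.6) p. 608 of the one-step transformation `T^{L^kε}_{a,L,A}` of THIS model in the case
`Ω = T^{(k)}`: `Π_{y ∈ T^{(k+1)}} (a(L^{k+1}ε)^{d−2}/2π)^{N/2} exp(−½ a (L^{k+1}ε)^{d−2} |ψ(y) − (Q(A)φ)(y)|²)` =
`B1RT.blockKernel` at the printed precision `B1RT.prec a (L^{k+1}ε) d` and the concrete average `avgQ`. [cite: Balaban1982Higgs1, (2.6) p.608] -/
noncomputable def rtKernelStep {k : ℕ} (C : ChargeData N) (a : ℝ) (A : VecField P 0) :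
    ScalarField P (k + 1) N → ScalarField P k N → ℝ :=
  B1RT.blockKernel (B1RT.prec a (P.mesh (k + 1)) P.d) (avgQ C A)

/-- The one-step renormalization transformation (2.4) p. 608 of THIS model in the case `Ω = T^{(k)}` (p. 610):
`ρ'(A, ψ) = ∫ dφ t^{L^kε}_{a,L,A}(T; ψ, φ) ρ(A, φ)` = `B1RT.rtOp` at the kernel `rtKernelStep` (Lebesgue measure `dφ` on
`T^{(k)} → ℝ^N`); `ρ` here is `ρ(A, ·)`. [cite: Balaban1982Higgs1, (2.4) p.608] -/
noncomputable def renormTransf {k : ℕ} (C : ChargeData N) (a : ℝ) (A : VecField P 0) (ρ : ScalarField P k N → ℝ) :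
    ScalarField P (k + 1) N → ℝ :=
  B1RT.rtOp (rtKernelStep C a A) ρ

/-- The kernel (2.10) p. 609 of the `k`-th order transformation `T^ε_{a_k,L^k,A}` of THIS model (`Ω = T_ε`):
`Π_{y ∈ T^{(k)}} (a_k(L^kε)^{d−2}/2π)^{N/2} exp(−½ a_k (L^kε)^{d−2} |ψ(y) − (Q_k(A)φ)(y)|²)`, `a_k = B1.aSeq a L k`
((2.15); `a₁ = a`). [cite: Balaban1982Higgs1, (2.10) p.609] -/
noncomputable def rtKernelK (C : ChargeData N) (a : ℝ) (A : VecField P 0) (k : ℕ) :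
    ScalarField P k N → ScalarField P 0 N → ℝ :=
  B1RT.blockKernel (B1RT.prec (B1.aSeq a P.L k) (P.mesh k) P.d) (avgQk C A k)

/-- The `k`-th order renormalization transformation `T^ε_{a_k,L^k,A}` ((2.4) with the kernel (2.10), p. 609) of THIS
model in the case `Ω = T_ε`. [cite: Balaban1982Higgs1, (2.10) p.609] -/
noncomputable def renormTransfK (C : ChargeData N) (a : ℝ) (A : VecField P 0) (k : ℕ) (ρ : ScalarField P 0 N → ℝ) :
    ScalarField P k N → ℝ :=
  B1RT.rtOp (rtKernelK C a A k) ρ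

/-- **(2.8)** p. 609 for the concrete one-step kernel of this model: `∫ dψ t^{L^kε}_{a,L,A}(T; ψ, φ) = 1` for `a > 0`
(instance of the tree's `B1RT.integral_blockKernel`; the precision `a(L^{k+1}ε)^{d−2}` is positive by
`B1RT.prec_pos` and `Params.mesh_pos`). [cite: Balaban1982Higgs1, (2.8) p.609] -/
theorem integral_rtKernelStep {k : ℕ} (C : ChargeData N) {a : ℝ} (ha : 0 < a) (A : VecField P 0)
    (φ : ScalarField P k N) : ∫ ψ, rtKernelStep C a A ψ φ = 1 :=
  B1RT.integral_blockKernel (B1RT.prec_pos ha (P.mesh_pos (k + 1)) P.d) (avgQ C A) φ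

end RT

/-! ## 5. v1.1 (append-only): linearity of `A(Γ)` in `A` and the group / unitarity properties of the transports -/

section Additivity

/-- (2.3) is linear in `A`: `(A + B)(⟨u, u + nεe_μ⟩) = A(…) + B(…)` (immediate from the definition as a sum over the
bonds of the segment). PROVED. [cite: Balaban1982Higgs1, (2.3) p.608] -/
theorem segSum_add (A B : VecField P 0) (u : Site P 0) (μ : Fin P.d) (n : ℕ) :
    segSum (A + B) u μ n = segSum A u μ n + segSum B u μ n := by
  simp [segSum, Finset.sum_add_distrib]

/-- (2.3) for the staircase contour (2.1) is linear in `A`: `(A + B)(Γ_{y,x}) = A(Γ_{y,x}) + B(Γ_{y,x})` — the form in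
which it enters (3.15) p. 614 (`A → A + ∂λ`). PROVED. [cite: Balaban1982Higgs1, (2.3) p.608] -/
theorem contourSum_add (A B : VecField P 0) (y x : Site P 0) :
    contourSum (A + B) y x = contourSum A y x + contourSum B y x := by
  simp [contourSum, segSum_add, Finset.sum_add_distrib]

/-- (2.3) for the composite contour (2.2) is linear in `A`: `(A + B)(Γ^{(k)}_{y,x}) = A(Γ^{(k)}_{y,x}) + B(Γ^{(k)}_{y,x})`.
PROVED. [cite: Balaban1982Higgs1, (2.2) p.608] -/
theorem multiContourSum_add (A B : VecField P 0) (k : ℕ) (x : Site P 0) :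
    multiContourSum (A + B) k x = multiContourSum A k x + multiContourSum B k x := by
  simp [multiContourSum, contourSum_add, Finset.sum_add_distrib]

variable {N : ℕ}

/-- The transports of (2.7) inherit the representation property of `U` (p. 605):
`U((A + B)(Γ_{y,x})) = U(A(Γ_{y,x})) U(B(Γ_{y,x}))` — the hypothesis `hgroup` of the tree's `B1.display315` ((3.15)
p. 614) at the concrete model. PROVED. [cite: Balaban1982Higgs1, (2.7) p.608] -/
theorem holQ_add {k : ℕ} (C : ChargeData N) (A B : VecField P 0) (y : Site P (k + 1)) (x : Site P k) :
    holQ C (A + B) y x = holQ C A y x ∘ₗ holQ C B y x := by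
  unfold holQ
  rw [contourSum_add, ChargeData.U_add]
  rfl

/-- The same for the composite transports of (2.11): `U((A + B)(Γ^{(k)}_{y,x})) = U(A(Γ^{(k)}_{y,x})) U(B(Γ^{(k)}_{y,x}))`.
PROVED. [cite: Balaban1982Higgs1, (2.11) p.609] -/
theorem holQk_add (C : ChargeData N) (A B : VecField P 0) (k : ℕ) (y : Site P k) (x : Site P 0) :
    holQk C (A + B) k y x = holQk C A k y x ∘ₗ holQk C B k y x := by
  unfold holQk
  rw [multiContourSum_add, ChargeData.U_add]
  rfl

/-- At `A = 0` the transport (2.7) is the identity (`U(0) = 1`, p. 605), so `Q(0)` is the plain block average.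
PROVED. [cite: Balaban1982Higgs1, (2.7) p.608] -/
theorem holQ_zero {k : ℕ} (C : ChargeData N) (y : Site P (k + 1)) (x : Site P k) :
    holQ C (0 : VecField P 0) y x = LinearMap.id := by
  unfold holQ
  rw [show contourSum (0 : VecField P 0) (toFinest y) (toFinest x) = 0 by simp [contourSum, segSum],
    ChargeData.U_zero]
  rfl

/-- The transports of (2.7) are unitary (p. 605: `U(A)` is *"in unitary operators on R^N"*): `|U(A(Γ_{y,x}))v| = |v|`
— with linearity, the isometry hypothesis `hiso` of the tree's `B2LargeField.norm_transport_sub_le` (II (2.16) p. 570)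
at the concrete model. PROVED. [cite: Balaban1982Higgs1, (2.7) p.608] -/
theorem norm_holQ_apply {k : ℕ} (C : ChargeData N) (A : VecField P 0) (y : Site P (k + 1)) (x : Site P k)
    (v : EuclideanSpace ℝ (Fin N)) : ‖holQ C A y x v‖ = ‖v‖ :=
  ContinuousLinearMap.norm_map_of_mem_unitary (C.U_mem_unitary _ _) v

/-- The composite transports of (2.11) are unitary: `|U(A(Γ^{(k)}_{y,x}))v| = |v|`. PROVED. [cite: Balaban1982Higgs1, (2.11) p.609] -/
theorem norm_holQk_apply (C : ChargeData N) (A : VecField P 0) (k : ℕ) (y : Site P k) (x : Site P 0)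
    (v : EuclideanSpace ℝ (Fin N)) : ‖holQk C A k y x v‖ = ‖v‖ :=
  ContinuousLinearMap.norm_map_of_mem_unitary (C.U_mem_unitary _ _) v

/-- (3.15) p. 614 AT THE CONCRETE MODEL: `Q_k(A + B)φ = Q_k(B)φ + F_{2,k}(A,B)φ`,
`(F_{2,k}(A,B)φ)(y) = L^{-kd} Σ_{x ∈ B^k(y)} F′_{1,k}(A(Γ^{(k)}_{y,x})) U(B(Γ^{(k)}_{y,x})) φ(x)` with `F′_{1,k} = U − 1`
((3.14)) — the tree's abstract `B1.display315` instantiated at `avgQk`/`holQk` through `holQk_add`; nothing new is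
asserted. PROVED. [cite: Balaban1982Higgs1, (3.15) p.614] -/
theorem avgQk_add (C : ChargeData N) (A B : VecField P 0) (k : ℕ) (f : ScalarField P 0 N) :
    avgQk C (A + B) k f = avgQk C B k f
      + B1.blockAvg (((P.L : ℝ) ^ (k * P.d))⁻¹) (blockK k)
          (fun y x => (holQk C A k y x - LinearMap.id) ∘ₗ holQk C B k y x) f :=
  B1.display315 _ _ (holQk C A k) (holQk C B k) (holQk C (A + B) k) (fun y x => holQk C A k y x - LinearMap.id)
    (holQk_add C A B k) (fun y x => (add_sub_cancel LinearMap.id (holQk C A k y x)).symm) f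

end Additivity

end Literature.MathematicalPhysics.QuantumFieldTheory.Balaban1983to89.HiggsAveraging
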